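import Summits.AtomisticToContinuum.Crystallization.Theorems.OverbindingBudgetAffineFarTailSplit
import Summits.AtomisticToContinuum.Crystallization.Theorems.OverbindingBudgetAffineFarChartSplit

/-!
# OverbindingBudget — the FAR tail transfer modulo the CORE-BALL GAUGE: recharts, Z3⁗ and its split Z3a ∧ Z3b⁗, the re-proved seam (v8)
# (decomp-a2c lens-4, generation 49 — minimal-counterexample lens applied to the v7 cut Z3‴ ⟸ Z3a ∧ Z3b‴ of `…FarTailSplit`)

WHY (the generation-49 witness, memo `COUNTEREX-g49-Z3b.md`, script `z3b_witness.py`): Z3b‴ `ShelteredInflowWallLaw` is FALSE as typed (given R_aff).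
fcc at the LJ spacing under a uniform strain `3·10⁻³` (every interior site good, far, normal, sheltered) with Shockley-shifted slabs of 40 `(11-1)`-layers is
a Barlow stacking about the axis `(11-1)`; Z3b‴ quantifies over ALL admissible `Cε₁`-exact charts `F`, and `IsChart` leaves the LAYER AXIS free whenever the
`9·nn` core ball is unfaulted fcc, while `Continues θ c c'` pins `c'.B = c.B`: for a `(111)`-axis chart every continuation has its structure points at
`(111)`-heights in `d₁₁₁·ℤ`, the shifted slabs sit at fractional height `1/3, 2/3`, i.e. `≥ 0.2635·nn₀` from every structure point `>` the cap `matchTol ≤ nn/4`,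
so they are unmatched for EVERY continuation and matching; each unmatched tail term `−tailW·V` is `> 0`, the inflow is `≥ 2.1·10⁻⁵` per interior site
(volume-like) while `#Gᶜ` is the surface skin and `ε₁ ≤ ε_W` is free.  Z3‴ itself survives the family (in-plane slab shifts move a tail by a 2D Poisson
remainder `≲ e^{−|G_min| z} ≈ e^{−65}`) — the CUT is what dies: the matching language cannot see in-plane-shift invariance across a foreign plane family.
THE RE-CUT (this file): quotient the continuation relation by the finite GAUGE of the core ball — `Recharts θ c c'`: `c'` admissible, same scale and nearest
distance, `c'.B = c.B ∘ R` for a linear isometry `R`, and the same PHYSICAL structure points in the open core ball (`R p ∈ 𝓛(c.s) ↔ p ∈ 𝓛(c'.s)` whenever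
`a₀‖B(R p)‖ < (44/5)·nn`).  A wrong-axis fcc chart recharts to the true axis; an axis is forced exactly when the core ball contains an h-plane, and then a
foreign fault family must CROSS it (crossing/termination lines are non-good: walls pay, `Σ_dyadic d²·d⁻³ < ∞` per unit line).
§1 `Recharts`, `rechartTailInf θ c := inf {refTail c' | Recharts θ c c'}`; `Continues ⇒ Recharts`; rechart classes of recharting charts coincide.
§2 the reference smooth CORE (reindex the structure series by `R`, `Equiv.tsum_eq`) and `PatternFar` (`π ↦ R⁻¹ ∘ π`) are rechart-invariant; `refTail` is
bounded below on a rechart class (`θ ≤ 1/18`): `rechartTailInf` is a genuine infimum, `≤ tailInf`.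
§3 Z3⁗ `RechartedTailTransferInf θ θ₀` (= Z3‴ with `rechartTailInf`) + selection form; ★ PROVED `ShelteredTailTransferInf → Z3⁗` (WEAKER than the tree's
Z3‴; strictly on paper: Z3‴ must transfer adversarial-axis charts by the Poisson lemma, Z3⁗ need not).
§4 SEAM v8 (PROVED; the v7 proof with the continuation facts replaced by their rechart versions):
`FarCoreExcess → ShelteredCoreRegistration → RechartedTailTransferSel → ScaleBadFloor → θ ≤ 1/5 → FarAggregatePricing 12 θ θ₀ κ`, Inf form, record.
§5 Z3b⁗ `RechartedInflowWallLaw θ θ₀` (= Z3b‴ with `Recharts`; TRUE-type on paper · ATTACKABLE-L · UNDECIDED — census test: wall-free everywhere-`AffReg`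
textures with volume-like unmatched inflow under FREE axis choice), ★ PROVED `ShelteredInflowWallLaw → Z3b⁗`, the PROVED glue `θ ≤ 1/18 → TailDriftBound →
Z3b⁗ → Z3⁗` (Z3a = the tree's), record corollary, and the six-leaf record composition `Z2 → Zr‴a → Zr‴b → Z3a → Z3b⁗ → Z4″ → FarAggregatePricing 12
(1/25) (1/2000) (1/(2·10⁷))` over the tree's ChartSplit.  No sorry · no instance/notation/option · imports tree TailSplit v7 + ChartSplit.
-/

namespace Summit.AtomisticToContinuum.Crystallization.Theorems.OverbindingBudgetAffineFarSmoothSplit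

open scoped BigOperators Classical
open Literature.MathematicalPhysics.StatisticalMechanics
open Literature.Geometry.DiscreteGeometry (nearestDist nearestDist_nonneg fccTwoShellPattern hcpTwoShellPattern)
open Summit.AtomisticToContinuum.Crystallization.Theorems.OverbindingBudgetBalancedCensusStatements
open Summit.AtomisticToContinuum.Crystallization.Theorems.OverbindingBudgetAffineLadder
open Summit.AtomisticToContinuum.Crystallization.Theorems.OverbindingBudgetAffineLocalisation

variable {N : ℕ}

local notation "E3" => EuclideanSpace ℝ (Fin 3)

/-! ## §1  Recharts: continuations modulo the core-ball gauge -/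

/-- `Recharts θ c c'`: `c'` is an admissible chart with the same scale and nearest distance as `c`, whose linear part is `c.B ∘ R` for a linear
isometry `R` of the reference space, and whose structure has the same PHYSICAL points as `c`'s in the open core ball `a₀‖B q‖ < (44/5)·nn`
(the structure point `p` of `c'` sits at `a₀ • c.B (R p)`).  `Continues` is the case `R = 1`. -/
def Recharts (θ : ℝ) (c c' : Chart) : Prop :=
  ChartAdmissible θ c' ∧ c'.a₀ = c.a₀ ∧ c'.nn = c.nn ∧ ∃ R : E3 ≃ₗᵢ[ℝ] E3, (∀ p : E3, c'.B p = c.B (R p)) ∧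
    ∀ p : E3, c.a₀ * ‖c.B (R p)‖ < 44 / 5 * c.nn →
      (R p ∈ barlowStacking 1 (Real.sqrt (2 / 3)) c.s ↔ p ∈ barlowStacking 1 (Real.sqrt (2 / 3)) c'.s)

/-- The RECHART INFIMUM of the reference tail: `inf {refTail c' | c' recharts c}`. -/
noncomputable def rechartTailInf (θ : ℝ) (c : Chart) : ℝ := sInf (refTail '' {c' | Recharts θ c c'})

/-- An admissible chart recharts itself (`R = 1`). [this file] -/
theorem recharts_refl {θ : ℝ} {c : Chart} (hc : ChartAdmissible θ c) : Recharts θ c c :=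
  ⟨hc, rfl, rfl, LinearIsometryEquiv.refl ℝ E3, fun _ => rfl, fun _ _ => Iff.rfl⟩

/-- **A continuation is a rechart** (`R = 1`). [this file] -/
theorem recharts_of_continues {θ : ℝ} {c c' : Chart} (h : Continues θ c c') : Recharts θ c c' :=
  ⟨h.1, h.2.2.1, h.2.2.2.1, LinearIsometryEquiv.refl ℝ E3, fun p => by rw [h.2.1]; rfl, fun p hp => h.2.2.2.2 p hp⟩

/-- Rechart classes of recharting charts coincide. [this file] -/
theorem recharts_iff_of_recharts {θ : ℝ} {c c' : Chart} (h : Recharts θ c c') {d : Chart} :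
    Recharts θ c d ↔ Recharts θ c' d := by
  obtain ⟨-, ha, hn, R₁, hB₁, hball₁⟩ := h
  constructor
  · rintro ⟨hd, ha', hn', R₂, hB₂, hball₂⟩
    refine ⟨hd, ha'.trans ha.symm, hn'.trans hn.symm, R₂.trans R₁.symm, fun p => ?_, fun p hp => ?_⟩
    · rw [LinearIsometryEquiv.coe_trans, Function.comp_apply, hB₁, LinearIsometryEquiv.apply_symm_apply, hB₂]
    · rw [LinearIsometryEquiv.coe_trans, Function.comp_apply, hB₁, LinearIsometryEquiv.apply_symm_apply, ha, hn] at hp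
      rw [LinearIsometryEquiv.coe_trans, Function.comp_apply]
      have h1 := hball₁ (R₁.symm (R₂ p)) (by rw [LinearIsometryEquiv.apply_symm_apply]; exact hp)
      rw [LinearIsometryEquiv.apply_symm_apply] at h1
      exact h1.symm.trans (hball₂ p hp)
  · rintro ⟨hd, ha', hn', R₃, hB₃, hball₃⟩
    refine ⟨hd, ha'.trans ha, hn'.trans hn, R₃.trans R₁, fun p => ?_, fun p hp => ?_⟩
    · rw [LinearIsometryEquiv.coe_trans, Function.comp_apply, ← hB₁, hB₃]
    · rw [LinearIsometryEquiv.coe_trans, Function.comp_apply] at hp ⊢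
      have h3 := hball₃ p (by rw [hB₁, ha, hn]; exact hp)
      exact (hball₁ (R₃ p) hp).trans h3

/-- Recharting charts have the same rechart infimum. [this file] -/
theorem rechartTailInf_eq_of_recharts {θ : ℝ} {c c' : Chart} (h : Recharts θ c c') : rechartTailInf θ c' = rechartTailInf θ c := by
  unfold rechartTailInf; congr 1; ext x
  simp only [Set.mem_image, Set.mem_setOf_eq, recharts_iff_of_recharts h]

/-- ε-minimisers of the rechart infimum (the class is nonempty: `c` itself). [this file] -/
theorem exists_recharts_lt {θ : ℝ} {c : Chart} (hc : ChartAdmissible θ c) {ξ : ℝ} (hξ : 0 < ξ) :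
    ∃ c' : Chart, Recharts θ c c' ∧ refTail c' < rechartTailInf θ c + ξ := by
  have hne : (refTail '' {c' | Recharts θ c c'}).Nonempty := ⟨refTail c, c, recharts_refl hc, rfl⟩
  obtain ⟨x, ⟨c', hc', rfl⟩, hlt⟩ := exists_lt_of_csInf_lt hne (lt_add_of_pos_right (rechartTailInf θ c) hξ)
  exact ⟨c', hc', hlt⟩

/-! ## §2  Rechart invariance of the reference smooth core and of `PatternFar`; the rechart infimum is genuine -/

/-- `refTail` is bounded below on every rechart class (`θ ≤ 1/18`; the BarlowSum′ majorant depends on the scale only). [this file] -/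
theorem bddBelow_refTail_recharts {θ : ℝ} (hθ : θ ≤ 1 / 18) (c : Chart) : BddBelow (refTail '' {c' | Recharts θ c c'}) := by
  refine ⟨-(1 / 2 * ∑' t : ℤ × ℤ × ℤ, ljMajorant c.a₀ (3 * θ) t), ?_⟩
  rintro _ ⟨c', hc', rfl⟩
  have h := neg_majorant_le_refTail hθ hc'.1
  rw [hc'.2.1] at h
  exact h

/-- `rechartTailInf θ c ≤ refTail c'` for every rechart `c'` of `c` (`θ ≤ 1/18`). [this file] -/
theorem rechartTailInf_le_refTail_of_recharts {θ : ℝ} (hθ : θ ≤ 1 / 18) {c c' : Chart} (h : Recharts θ c c') :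
    rechartTailInf θ c ≤ refTail c' :=
  csInf_le (bddBelow_refTail_recharts hθ c) ⟨c', h, rfl⟩

/-- **`rechartTailInf ≤ tailInf`** (the rechart class contains the continuation class; `θ ≤ 1/18`). [this file] -/
theorem rechartTailInf_le_tailInf {θ : ℝ} (hθ : θ ≤ 1 / 18) {c : Chart} (hc : ChartAdmissible θ c) : rechartTailInf θ c ≤ tailInf θ c :=
  csInf_le_csInf (bddBelow_refTail_recharts hθ c) ⟨refTail c, c, continues_refl hc, rfl⟩
    (Set.image_mono fun _ h => recharts_of_continues h)

/-- **The reference smooth CORE is rechart-invariant** (reindex the series by `R`; points agree on the core ball, the summand vanishes off it). [this file] -/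
theorem core_eq_of_recharts {θ : ℝ} {c c' : Chart} (hc : ChartAdmissible θ c) (h : Recharts θ c c') :
    refEnergy c' - refTail c' = refEnergy c - refTail c := by
  obtain ⟨hc', ha, hn, R, hB, hball⟩ := h
  rw [refEnergy_sub_refTail_eq hc', refEnergy_sub_refTail_eq hc]
  congr 1
  have hfg : ∀ p : E3, (barlowStacking 1 (Real.sqrt (2 / 3)) c'.s).indicator (coreTerm c'.B c'.a₀ c'.nn) p
      = (barlowStacking 1 (Real.sqrt (2 / 3)) c.s).indicator (coreTerm c.B c.a₀ c.nn) (R.toLinearEquiv.toEquiv p) := by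
    intro p
    rw [LinearEquiv.coe_toEquiv, LinearIsometryEquiv.coe_toLinearEquiv]
    have hct : coreTerm c'.B c'.a₀ c'.nn p = coreTerm c.B c.a₀ c.nn (R p) := by unfold coreTerm; rw [hB p, ha, hn]
    by_cases hp : c.a₀ * ‖c.B (R p)‖ < 44 / 5 * c.nn
    · simp only [Set.indicator_apply, hct, hball p hp]
    · have h0 : coreTerm c.B c.a₀ c.nn (R p) = 0 := by
        unfold coreTerm; rw [tailW_eq_one hc.2.2.1 (not_lt.mp hp), sub_self, zero_mul]
      simp only [Set.indicator_apply, hct, h0, ite_self]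
  rw [tsum_congr hfg]
  exact Equiv.tsum_eq R.toLinearEquiv.toEquiv _

/-- **`PatternFar` is rechart-invariant** (`θ ≤ 1/5`; the frame is kept, the matching is composed with `R⁻¹`). [this file] -/
theorem patternFar_of_recharts {θ θ₀ s : ℝ} {c c' : Chart} (hc : ChartAdmissible θ c) (hθ : θ ≤ 1 / 5)
    (h : Recharts θ c c') (hP : PatternFar θ₀ s c) : PatternFar θ₀ s c' := by
  obtain ⟨-, ha, hn, R, hB, hball⟩ := h
  obtain ⟨A₀, P, π, hPP, hm, hinj, hfar⟩ := hP
  refine ⟨A₀, P, fun v => R.symm (π v), hPP, fun v hv => ?_, fun v hv w hw hvw => hinj hv hw (R.symm.injective hvw), hfar⟩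
  obtain ⟨⟨hmem, hne, hnorm⟩, hfit⟩ := hm v hv
  have hcore : c.a₀ * ‖c.B (R (R.symm (π v)))‖ < 44 / 5 * c.nn := by
    rw [LinearIsometryEquiv.apply_symm_apply]; exact coreBall_of_norm_le hc hθ hnorm
  refine ⟨⟨(hball _ hcore).mp (by rw [LinearIsometryEquiv.apply_symm_apply]; exact hmem),
    fun h0 => hne (by simpa using congrArg R h0), by rw [LinearIsometryEquiv.norm_map]; exact hnorm⟩, ?_⟩
  rw [hB, LinearIsometryEquiv.apply_symm_apply, ha, hn]; exact hfit

/-! ## §3  Z3⁗: the sheltered tail transfer with the rechart infimum -/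

/-- **Z3⁗ · `RechartedTailTransferInf θ θ₀`** (v8 · TRUE-type on paper · ATTACKABLE-L · WEAKER than the tree's Z3‴ `ShelteredTailTransferInf` —
PROVED `rechartedTailTransferInf_of_sheltered`; strictly on paper: Z3‴ must also transfer adversarial-AXIS charts, by the 2D Poisson remainder): R_aff ⇒
`∀ C ≥ 0 ∀ R ≥ 0 ∃ C', ε_B ∀ ε₁ ≤ ε_B ∀ δ ∈ (0,2] ∃ C_T ≥ 0 ∀ N y F`: `Σ_{i ∈ Sh_R} (rechartTailInf θ (F i) − smoothTail G y i) ≤ C_T·#Gᶜ + C'·ε₁·#Sh_R`.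
Might fail: a wall-free regular denser good region beating the drift law (module doc of the Seam; unchanged). -/
def RechartedTailTransferInf (θ θ₀ : ℝ) : Prop :=
  AffineChartStraightening →
  ∀ C : ℝ, 0 ≤ C → ∀ R : ℝ, 0 ≤ R → ∃ C' εB : ℝ, 0 ≤ C' ∧ 0 < εB ∧
    ∀ ε₁ : ℝ, 0 < ε₁ → ε₁ ≤ εB → ∀ δ : ℝ, 0 < δ → δ ≤ 2 →
    ∃ CT : ℝ, 0 ≤ CT ∧ ∀ (N : ℕ) (y : Fin N → E3), Function.Injective y → ∀ F : Fin N → Chart,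
      (∀ i ∈ shelteredFarSet R θ₀ 12 ε₁ θ δ y, IsChart C ε₁ y i (F i) ∧ ChartAdmissible θ (F i)) →
        ∑ i ∈ shelteredFarSet R θ₀ 12 ε₁ θ δ y, (rechartTailInf θ (F i) - smoothTail (goodSet 12 ε₁ θ δ y) y i)
          ≤ CT * (((goodSet 12 ε₁ θ δ y)ᶜ).card : ℝ) + C' * ε₁ * ((shelteredFarSet R θ₀ 12 ε₁ θ δ y).card : ℝ)

/-- **Z3⁗ (selection form) · `RechartedTailTransferSel θ θ₀`**: a sitewise RECHART `F'` with `Σ (refTail (F' i) − smoothTail G y i) ≤ …` (the seam's input). -/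
def RechartedTailTransferSel (θ θ₀ : ℝ) : Prop :=
  AffineChartStraightening →
  ∀ C : ℝ, 0 ≤ C → ∀ R : ℝ, 0 ≤ R → ∃ C' εB : ℝ, 0 ≤ C' ∧ 0 < εB ∧
    ∀ ε₁ : ℝ, 0 < ε₁ → ε₁ ≤ εB → ∀ δ : ℝ, 0 < δ → δ ≤ 2 →
    ∃ CT : ℝ, 0 ≤ CT ∧ ∀ (N : ℕ) (y : Fin N → E3), Function.Injective y → ∀ F : Fin N → Chart,
      (∀ i ∈ shelteredFarSet R θ₀ 12 ε₁ θ δ y, IsChart C ε₁ y i (F i) ∧ ChartAdmissible θ (F i)) →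
        ∃ F' : Fin N → Chart,
          (∀ i ∈ shelteredFarSet R θ₀ 12 ε₁ θ δ y, Recharts θ (F i) (F' i)) ∧
          ∑ i ∈ shelteredFarSet R θ₀ 12 ε₁ θ δ y, (refTail (F' i) - smoothTail (goodSet 12 ε₁ θ δ y) y i)
            ≤ CT * (((goodSet 12 ε₁ θ δ y)ᶜ).card : ℝ) + C' * ε₁ * ((shelteredFarSet R θ₀ 12 ε₁ θ δ y).card : ℝ)

/-- **Infimum form ⇒ selection form** (`C' ↦ C' + 1`, via `ε₁`-minimisers). [this file] -/
theorem rechartedTailTransferSel_of_inf {θ θ₀ : ℝ} (h : RechartedTailTransferInf θ θ₀) : RechartedTailTransferSel θ θ₀ := by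
  intro hR C hC R hR0
  obtain ⟨C', εB, hC', hεB, hZ⟩ := h hR C hC R hR0
  refine ⟨C' + 1, εB, by linarith, hεB, fun ε₁ hε₁ hε₁B δ hδ hδ2 => ?_⟩
  obtain ⟨CT, hCT, hZ'⟩ := hZ ε₁ hε₁ hε₁B δ hδ hδ2
  refine ⟨CT, hCT, fun N y hy F hF => ?_⟩
  set G := goodSet 12 ε₁ θ δ y
  set Sh := shelteredFarSet R θ₀ 12 ε₁ θ δ y
  have hch : ∀ i : Fin N, ∃ c' : Chart, i ∈ Sh → Recharts θ (F i) c' ∧ refTail c' < rechartTailInf θ (F i) + ε₁ := by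
    intro i
    by_cases hi : i ∈ Sh
    · obtain ⟨c', hc', hlt⟩ := exists_recharts_lt (hF i hi).2 hε₁
      exact ⟨c', fun _ => ⟨hc', hlt⟩⟩
    · exact ⟨F i, fun h1 => absurd h1 hi⟩
  choose F' hF' using hch
  refine ⟨F', fun i hi => (hF' i hi).1, ?_⟩
  have hT := hZ' N y hy F hF
  have hle : ∑ i ∈ Sh, (refTail (F' i) - smoothTail G y i) ≤ ∑ i ∈ Sh, ((rechartTailInf θ (F i) - smoothTail G y i) + ε₁) :=
    Finset.sum_le_sum fun i hi => by have h' := (hF' i hi).2; linarith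
  rw [Finset.sum_add_distrib, Finset.sum_const, nsmul_eq_mul] at hle
  linarith

/-- ★ **Z3‴ ⇒ Z3⁗** (`θ ≤ 1/18`): the rechart infimum is below the continuation infimum, row by row — the v8 piece is WEAKER than the tree's. [this file] -/
theorem rechartedTailTransferInf_of_sheltered {θ θ₀ : ℝ} (hθ : θ ≤ 1 / 18) (h : ShelteredTailTransferInf θ θ₀) :
    RechartedTailTransferInf θ θ₀ := by
  intro hR C hC R hR0
  obtain ⟨C', εB, hC', hεB, hZ⟩ := h hR C hC R hR0
  refine ⟨C', εB, hC', hεB, fun ε₁ hε₁ hε₁B δ hδ hδ2 => ?_⟩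
  obtain ⟨CT, hCT, hZ'⟩ := hZ ε₁ hε₁ hε₁B δ hδ hδ2
  refine ⟨CT, hCT, fun N y hy F hF => le_trans (Finset.sum_le_sum fun i hi => ?_) (hZ' N y hy F hF)⟩
  exact sub_le_sub_right (rechartTailInf_le_tailInf hθ (hF i hi).2) _

/-! ## §4  The seam, v8 (sheltered rows recharted) -/

/-- **LAYER-5 SEAM (PROVED, v8):
`FarCoreExcess → ShelteredCoreRegistration → RechartedTailTransferSel → ScaleBadFloor → θ ≤ 1/5 → FarAggregatePricing 12 θ θ₀ κ`.**
Verbatim the v7 seam with `core_eq_of_recharts` / `patternFar_of_recharts` for their continuation versions: Z2 is applied at the recharted `c'`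
(admissible, `PatternFar`-far, same smooth core as Zr‴'s chart). [this file] -/
theorem farAggregatePricing_of_rechartedSeam {θ θ₀ κ : ℝ} (h2 : FarCoreExcess θ θ₀ κ) (hr : ShelteredCoreRegistration θ θ₀)
    (h3 : RechartedTailTransferSel θ θ₀) (h4 : ScaleBadFloor θ κ) (hθ : θ ≤ 1 / 5) : FarAggregatePricing 12 θ θ₀ κ := by
  intro hR
  obtain ⟨m, τ, hm, hτ, hZ2⟩ := h2
  obtain ⟨R, C, C₂, εA, hR0, hC, hC₂, hεA, hZr⟩ := hr hR τ hτ
  obtain ⟨C', εB, hC', hεB, hZ3⟩ := h3 hR C hC R hR0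
  obtain ⟨p, εC, hp, hεC, hZ4⟩ := h4 hR
  have hden : 0 < C₂ + C' + 1 := by linarith
  refine ⟨min (min εA εB) (min εC (m / (C₂ + C' + 1))),
    lt_min (lt_min hεA hεB) (lt_min hεC (div_pos hm hden)), fun ε₁ hε₁ hε₁le δ hδ hδ2 => ?_⟩
  have hεA' : ε₁ ≤ εA := hε₁le.trans ((min_le_left _ _).trans (min_le_left _ _))
  have hεB' : ε₁ ≤ εB := hε₁le.trans ((min_le_left _ _).trans (min_le_right _ _))
  have hεC' : ε₁ ≤ εC := hε₁le.trans ((min_le_right _ _).trans (min_le_left _ _))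
  have hεm' : (C₂ + C') * ε₁ ≤ m := by
    have h1 := mul_le_mul_of_nonneg_left (hε₁le.trans ((min_le_right _ _).trans (min_le_right _ _))) hden.le
    rw [mul_div_cancel₀ _ hden.ne'] at h1; nlinarith
  obtain ⟨CT, hCT, hZ3'⟩ := hZ3 ε₁ hε₁ hεB' δ hδ hδ2
  obtain ⟨C4, hC4, hZ4'⟩ := hZ4 ε₁ hε₁ hεC' δ hδ hδ2
  set e : ℝ := ⨅ Q : PeriodicConfiguration 3, Q.energyPerParticle lennardJones
  set K : ℝ := (4 * R / δ + 1) ^ 3 with hK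
  set Crow : ℝ := 1024 / (12 * δ ^ 6) with hCrow
  have hK0 : 0 ≤ K := by positivity
  have hCrow0 : 0 ≤ Crow := by positivity
  have hA0 : 0 ≤ |e + κ| := abs_nonneg _
  refine ⟨p, CT + C4 + K * (Crow + |e + κ|), hp, by positivity, fun N y hy => ?_⟩
  set G := goodSet 12 ε₁ θ δ y
  set Far := farSet θ₀ 12 ε₁ θ δ y
  set sb := goodScaleBadSet 12 ε₁ θ δ y
  set Fn := Far \ sb
  set Sh := shelteredFarSet R θ₀ 12 ε₁ θ δ y
  set Un := Fn \ Sh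
  have hsub : sb ⊆ Far := goodScaleBadSet_subset_farSet θ₀ 12 ε₁ θ δ y
  have hShFn : Sh ⊆ Fn := shelteredFarSet_subset R θ₀ 12 ε₁ θ δ y
  have hFarG : Far ⊆ G := farSet_subset_goodSet θ₀ 12 ε₁ θ δ y
  have hUnG : Un ⊆ G := (Finset.sdiff_subset).trans ((Finset.sdiff_subset).trans hFarG)
  -- charts on the sheltered class
  have hch : ∀ i : Fin N, ∃ c : Chart, i ∈ Sh →
      IsChart C ε₁ y i c ∧ ChartAdmissible θ c ∧ PatternFar θ₀ τ c ∧
        refEnergy c - refTail c - C₂ * ε₁ ≤ smoothCore G y i := by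
    intro i
    by_cases hi : i ∈ Sh
    · obtain ⟨c, hc⟩ := hZr ε₁ hε₁ hεA' δ hδ hδ2 N y hy i hi
      exact ⟨c, fun _ => hc⟩
    · exact ⟨⟨fun _ => 0, 0, 1, 1⟩, fun h => absurd h hi⟩
  choose F hF using hch
  obtain ⟨F', hF', hT⟩ := hZ3' N y hy F fun i hi => let h := hF i hi; ⟨h.1, h.2.1⟩
  -- sheltered rows
  have hrows : ∑ i ∈ Sh, (e + κ + m - C₂ * ε₁ - (refTail (F' i) - smoothTail G y i))
      ≤ ∑ i ∈ Sh, (smoothCore G y i + smoothTail G y i) := by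
    refine Finset.sum_le_sum fun i hi => ?_
    have h := hF i hi
    have hc' := hF' i hi
    have hz := hZ2 (F' i) hc'.1 (patternFar_of_recharts h.2.1 hθ hc' h.2.2.1)
    have hcore := core_eq_of_recharts h.2.1 hc'
    linarith [h.2.2.2]
  have hconst : ∑ i ∈ Sh, (e + κ + m - C₂ * ε₁ - (refTail (F' i) - smoothTail G y i))
      = (Sh.card : ℝ) * (e + κ + m - C₂ * ε₁) - ∑ i ∈ Sh, (refTail (F' i) - smoothTail G y i) := by
    rw [Finset.sum_sub_distrib, Finset.sum_const, nsmul_eq_mul]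
  have hShrows : ∑ i ∈ Sh, (smoothCore G y i + smoothTail G y i) = 1 / 2 * pairSum Sh G y :=
    sum_smoothCore_add_smoothTail Sh G y
  -- unsheltered rows: crude floor and packing count
  have hUnrows : -Crow * (Un.card : ℝ) ≤ 1 / 2 * pairSum Un G y := half_pairSum_ge_of_subset_goodSet hδ hy hUnG
  have hUn : (Un.card : ℝ) ≤ K * ((Gᶜ.card : ℕ) : ℝ) := card_far_not_sheltered_le hR0 hδ hy
  have hUn1 : Crow * (Un.card : ℝ) ≤ Crow * (K * ((Gᶜ.card : ℕ) : ℝ)) := mul_le_mul_of_nonneg_left hUn hCrow0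
  have hUn2 : (Un.card : ℝ) * (e + κ) ≤ |e + κ| * (K * ((Gᶜ.card : ℕ) : ℝ)) := by
    have h1 : (Un.card : ℝ) * (e + κ) ≤ (Un.card : ℝ) * |e + κ| := mul_le_mul_of_nonneg_left (le_abs_self _) (Nat.cast_nonneg _)
    have h2 : (Un.card : ℝ) * |e + κ| ≤ K * ((Gᶜ.card : ℕ) : ℝ) * |e + κ| := mul_le_mul_of_nonneg_right hUn hA0
    linarith
  -- scale-bad rows
  have h4' := hZ4' N y hy
  -- the decomposition Far = Sh ∪ Un ∪ sb
  have hunion : Fn ∪ sb = Far := Finset.sdiff_union_of_subset hsub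
  have hdisj : Disjoint Fn sb := Finset.sdiff_disjoint
  have hunion' : Sh ∪ Un = Fn := Finset.union_sdiff_of_subset hShFn
  have hdisj' : Disjoint Sh Un := Finset.disjoint_sdiff
  have hpair : pairSum Far G y = pairSum Sh G y + pairSum Un G y + pairSum sb G y := by
    rw [← hunion, pairSum_union_left hdisj G y, ← hunion', pairSum_union_left hdisj' G y]
  have hcard : (Sh.card : ℝ) + (Un.card : ℝ) + (sb.card : ℝ) = (Far.card : ℝ) := by
    have h1 : Fn.card + sb.card = Far.card := Finset.card_sdiff_add_card_eq_card hsub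
    have h2 : Un.card + Sh.card = Fn.card := Finset.card_sdiff_add_card_eq_card hShFn
    have h3 : Sh.card + Un.card + sb.card = Far.card := by omega
    exact_mod_cast h3
  have hSh0 : (0 : ℝ) ≤ (Sh.card : ℝ) := Nat.cast_nonneg _
  have hmSh : (C₂ + C') * ε₁ * (Sh.card : ℝ) ≤ m * (Sh.card : ℝ) := mul_le_mul_of_nonneg_right hεm' hSh0
  show (Far.card : ℝ) * e + κ * (Far.card : ℝ) + p * (sb.card : ℝ) - (CT + C4 + K * (Crow + |e + κ|)) * ((Gᶜ.card : ℕ) : ℝ)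
      ≤ 1 / 2 * pairSum Far G y
  rw [hpair, ← hcard]
  nlinarith [hrows, hconst, hShrows, h4', hT, hmSh, hSh0, hUnrows, hUn1, hUn2]

/-- The seam from the INFIMUM form of Z3⁗. [this file] -/
theorem farAggregatePricing_of_rechartedSeamInf {θ θ₀ κ : ℝ} (h2 : FarCoreExcess θ θ₀ κ) (hr : ShelteredCoreRegistration θ θ₀)
    (h3 : RechartedTailTransferInf θ θ₀) (h4 : ScaleBadFloor θ κ) (hθ : θ ≤ 1 / 5) : FarAggregatePricing 12 θ θ₀ κ :=
  farAggregatePricing_of_rechartedSeam h2 hr (rechartedTailTransferSel_of_inf h3) h4 hθ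

/-- **The v8 seam at the literals of record**: Z2, Zr‴, Z3⁗, Z4″ at `(1/25, 1/2000, 1/(2·10⁷))` give `FarAggregatePricing 12 (1/25) (1/2000) (1/(2·10⁷))`,
the `hZ` slot of the tree cone `tbdsg_of_nearCritical_record'_bt_d`. [this file] -/
theorem farAggregatePricing_record_of_rechartedSeam
    (h2 : FarCoreExcess (1 / 25) (1 / 2000) (1 / (2 * 10 ^ 7))) (hr : ShelteredCoreRegistration (1 / 25) (1 / 2000))
    (h3 : RechartedTailTransferInf (1 / 25) (1 / 2000)) (h4 : ScaleBadFloor (1 / 25) (1 / (2 * 10 ^ 7))) :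
    FarAggregatePricing 12 (1 / 25) (1 / 2000) (1 / (2 * 10 ^ 7)) :=
  farAggregatePricing_of_rechartedSeamInf h2 hr h3 h4 (by norm_num)

/-! ## §5  Z3b⁗: the inflow wall law with recharts, the glue Z3a ∧ Z3b⁗ ⇒ Z3⁗, and the six-leaf record composition -/

/-- **Z3b⁗ · `RechartedInflowWallLaw θ θ₀`** (v8 · TRUE-type on paper · ATTACKABLE-L · UNDECIDED; replaces Z3b‴ `ShelteredInflowWallLaw`, which is false in
evidence (generation-49 wrong-axis witness) and implies it, `rechartedInflowWallLaw_of_sheltered`): R_aff ⇒ `∀ C ≥ 0 ∀ R ≥ 0 ∃ D, C''' ≥ 0, ε_W > 0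
∀ ε₁ ≤ ε_W ∀ δ ∈ (0,2] ∃ C_T ≥ 0 ∀ N y F` (admissible `Cε₁`-exact charts on `Sh_R`): there are RECHARTS `F'` (free layer axis among those the core ball
allows, free stacking beyond the core), sub-classes `M i ⊆ G` and matchings `π i` with `Σ_{i∈Sh_R} −smoothTail (G ∖ M i) y i ≤ C_T·#Gᶜ + C'''·ε₁·#Sh_R`.
Why true (paper): a core ball without h-planes recharts to the axis of the nearest fault family; one with an h-plane forces the axis, and a foreign fault
family nearby must cross/terminate on it — such lines and grain walls are non-good and pay (`Σ_dyadic d²·d⁻³ < ∞` per unit line, `C_T` after `δ`); coherent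
drift is matched up to radius `≍ (Dε₁)^{-1/2}`, the overflow is `∝ ε₁^{3/2}`.  Might fail (CENSUS TEST): a wall-free everywhere-`AffReg(ε₁, 1/25)` texture
whose matter unmatched under the BEST axis choice is volume-like (excluded on paper by discrete compatibility / quasiconformal rigidity). -/
def RechartedInflowWallLaw (θ θ₀ : ℝ) : Prop :=
  AffineChartStraightening → ∀ C : ℝ, 0 ≤ C → ∀ R : ℝ, 0 ≤ R → ∃ D C''' εW : ℝ, 0 ≤ D ∧ 0 ≤ C''' ∧ 0 < εW ∧
    ∀ ε₁ : ℝ, 0 < ε₁ → ε₁ ≤ εW → ∀ δ : ℝ, 0 < δ → δ ≤ 2 → ∃ CT : ℝ, 0 ≤ CT ∧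
      ∀ (N : ℕ) (y : Fin N → E3), Function.Injective y → ∀ F : Fin N → Chart,
        (∀ i ∈ shelteredFarSet R θ₀ 12 ε₁ θ δ y, IsChart C ε₁ y i (F i) ∧ ChartAdmissible θ (F i)) →
          ∃ (F' : Fin N → Chart) (M : Fin N → Finset (Fin N)) (π : Fin N → Fin N → E3),
            (∀ i ∈ shelteredFarSet R θ₀ 12 ε₁ θ δ y,
              Recharts θ (F i) (F' i) ∧ M i ⊆ goodSet 12 ε₁ θ δ y ∧ Matched D ε₁ y i (F' i) (M i) (π i)) ∧
            ∑ i ∈ shelteredFarSet R θ₀ 12 ε₁ θ δ y, -smoothTail (goodSet 12 ε₁ θ δ y \ M i) y i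
              ≤ CT * (((goodSet 12 ε₁ θ δ y)ᶜ).card : ℝ) + C''' * ε₁ * ((shelteredFarSet R θ₀ 12 ε₁ θ δ y).card : ℝ)

/-- ★ **Z3b‴ ⇒ Z3b⁗** (a continuation is a rechart): the v8 piece is WEAKER than the v7 piece it replaces. [this file] -/
theorem rechartedInflowWallLaw_of_sheltered {θ θ₀ : ℝ} (h : ShelteredInflowWallLaw θ θ₀) : RechartedInflowWallLaw θ θ₀ := by
  intro hR C hC R hR0
  obtain ⟨D, C''', εW, hD, hC''', hεW, hW⟩ := h hR C hC R hR0
  refine ⟨D, C''', εW, hD, hC''', hεW, fun ε₁ hε₁ hε₁W δ hδ hδ2 => ?_⟩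
  obtain ⟨CT, hCT, hW'⟩ := hW ε₁ hε₁ hε₁W δ hδ hδ2
  refine ⟨CT, hCT, fun N y hy F hF => ?_⟩
  obtain ⟨F', M, π, hsel, hsum⟩ := hW' N y hy F hF
  exact ⟨F', M, π, fun i hi => let h := hsel i hi; ⟨recharts_of_continues h.1, h.2.1, h.2.2⟩, hsum⟩

/-- **GLUE (PROVED): Z3a → Z3b⁗ → Z3⁗** (`θ ≤ 1/18`; `rechartTailInf ≤ refTail (F' i)` by `rechartTailInf_le_refTail_of_recharts`, Z3a at the recharted
chart — admissible, same `nn` — and `smoothTail G = smoothTail (M i) + smoothTail (G ∖ M i)`; `C' := C'' + C'''`, `ε_B := min ε_D ε_W`). [this file] -/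
theorem rechartedTailTransferInf_of_drift_wall {θ θ₀ : ℝ} (hθ : θ ≤ 1 / 18) (ha : TailDriftBound θ θ₀) (hb : RechartedInflowWallLaw θ θ₀) :
    RechartedTailTransferInf θ θ₀ := by
  intro hR C hC R hR0
  obtain ⟨D, C''', εW, hD, hC''', hεW, hW⟩ := hb hR C hC R hR0
  obtain ⟨C'', εD, hC'', hεD, hA⟩ := ha hR C hC D hD
  refine ⟨C'' + C''', min εD εW, add_nonneg hC'' hC''', lt_min hεD hεW, fun ε₁ hε₁ hε₁le δ hδ hδ2 => ?_⟩
  have hεD' : ε₁ ≤ εD := hε₁le.trans (min_le_left _ _)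
  have hεW' : ε₁ ≤ εW := hε₁le.trans (min_le_right _ _)
  obtain ⟨CT, hCT, hW'⟩ := hW ε₁ hε₁ hεW' δ hδ hδ2
  refine ⟨CT, hCT, fun N y hy F hF => ?_⟩
  obtain ⟨F', M, π, hsel, hsum⟩ := hW' N y hy F hF
  set G := goodSet 12 ε₁ θ δ y
  set Sh := shelteredFarSet R θ₀ 12 ε₁ θ δ y
  have hterm : ∀ i ∈ Sh, rechartTailInf θ (F i) - smoothTail G y i ≤ C'' * ε₁ + -smoothTail (G \ M i) y i := by
    intro i hi
    have hi12 := (mem_shelteredFarSet.mp hi).1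
    obtain ⟨hrc, hMG, hmatch⟩ := hsel i hi
    have hch := hF i hi
    have hnn : |(F' i).nn - nearestDist y i| ≤ C * ε₁ * nearestDist y i := by rw [hrc.2.2.1]; exact hch.1.1
    have h1 : rechartTailInf θ (F i) ≤ refTail (F' i) := rechartTailInf_le_refTail_of_recharts hθ hrc
    have h2 : refTail (F' i) - smoothTail (M i) y i ≤ C'' * ε₁ :=
      hA ε₁ hε₁ hεD' δ hδ hδ2 N y hy i hi12.1 hi12.2 (F' i) hrc.1 hnn (M i) (π i) hmatch
    have h3 : smoothTail G y i = smoothTail (M i) y i + smoothTail (G \ M i) y i := smoothTail_eq_add_sdiff hMG y i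
    linarith
  have hsumle : ∑ i ∈ Sh, (rechartTailInf θ (F i) - smoothTail G y i) ≤ ∑ i ∈ Sh, (C'' * ε₁ + -smoothTail (G \ M i) y i) :=
    Finset.sum_le_sum hterm
  have hsplit : ∑ i ∈ Sh, (C'' * ε₁ + -smoothTail (G \ M i) y i)
      = (Sh.card : ℝ) * (C'' * ε₁) + ∑ i ∈ Sh, -smoothTail (G \ M i) y i := by
    rw [Finset.sum_add_distrib, Finset.sum_const, nsmul_eq_mul]
  have hSh0 : (0 : ℝ) ≤ (Sh.card : ℝ) := Nat.cast_nonneg _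
  show ∑ i ∈ Sh, (rechartTailInf θ (F i) - smoothTail G y i) ≤ CT * ((Gᶜ.card : ℕ) : ℝ) + (C'' + C''') * ε₁ * (Sh.card : ℝ)
  nlinarith [hsumle, hsplit, hsum, hSh0]

/-- **The split at the literals of record**: Z3a ∧ Z3b⁗ at `(1/25, 1/2000)` ⇒ Z3⁗. [this file] -/
theorem rechartedTailTransferInf_record_of_drift_wall (ha : TailDriftBound (1 / 25) (1 / 2000))
    (hb : RechartedInflowWallLaw (1 / 25) (1 / 2000)) : RechartedTailTransferInf (1 / 25) (1 / 2000) :=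
  rechartedTailTransferInf_of_drift_wall (by norm_num) ha hb
/-- **SLOT Z OF RECORD FROM THE SIX v8 LEAVES** (composition over the tree's ChartSplit and this file's seam and glue):
Z2 `FarCoreExcess` (CERT) → Zr‴a `ShelteredFarCharting` (M) → Zr‴b `NormalCorePricing` (S) → Z3a `TailDriftBound` (S/M) → Z3b⁗ `RechartedInflowWallLaw`
(L · UNDECIDED) → Z4″ `ScaleBadFloor` (M+CERT) → `FarAggregatePricing 12 (1/25) (1/2000) (1/(2·10⁷))`. [this file] -/
theorem farAggregatePricing_record_of_six_leaves
    (h2 : FarCoreExcess (1 / 25) (1 / 2000) (1 / (2 * 10 ^ 7))) (hra : ShelteredFarCharting (1 / 25) (1 / 2000))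
    (hrb : NormalCorePricing (1 / 25)) (h3a : TailDriftBound (1 / 25) (1 / 2000)) (h3b : RechartedInflowWallLaw (1 / 25) (1 / 2000))
    (h4 : ScaleBadFloor (1 / 25) (1 / (2 * 10 ^ 7))) : FarAggregatePricing 12 (1 / 25) (1 / 2000) (1 / (2 * 10 ^ 7)) :=
  farAggregatePricing_record_of_rechartedSeam h2 (shelteredCoreRegistration_record_of_charting_pricing hra hrb)
    (rechartedTailTransferInf_record_of_drift_wall h3a h3b) h4
end Summit.AtomisticToContinuum.Crystallization.Theorems.OverbindingBudgetAffineFarSmoothSplit
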